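import Literature.Probability.Percolation.RSWProofs
import Literature.Probability.Percolation.FiniteEnergy

/-!
# Sub-multiplicativity of the rectangle crossing probabilities of bond percolation on `ℤ²`
# (crux `SubseqCardy`, stmt-CriticalPhenomena-5768, line `registered`, lead c5: kernel facts, lattice input)

Route `CardyAnchoredRigidity` (decl shared with `CardyLocalRigidity`), sub-problem `CardyFormulaZ2`.
The one lattice estimate behind the boundary values and the strict monotonicity of sequential crossing
kernels (kernel facts, parts 2–3): for every `p` and all `a₁ a₂ b`,

  `crossingProb p (a₁ + a₂ + 1) b ≤ crossingProb p a₁ b * crossingProb p a₂ b`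

(`crossingProb p m n = P_p(LR([0, m] × [0, n]))`). An open left–right crossing of
`[0, a₁ + a₂ + 1] × [0, b]` contains, up to its first visit to the column `x = a₁`, a left–right
crossing of `[0, a₁] × [0, b]` (`lrCrossing_anti_left`), and, after its last visit to the column
`x = a₁ + 1`, a left–right crossing of the translate `(a₁ + 1, 0) + [0, a₂] × [0, b]`
(`exists_openConnIn_column_ge` on the reversed path); the two events read disjoint sets of edges, so
they are independent under the product measure `P_p` (`bondPercolation_real_inter_of_disjoint`), and the
translate has probability `crossingProb p a₂ b` (`real_openCrossing_shift`).

References: B. Bollobás, O. Riordan, *Percolation* (2006), Ch. 3 (proof of eq. (3)); G. Grimmett,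
*Percolation* (1999), §1.3 (product measure), §11.3.
-/

noncomputable section

namespace Summit.CriticalPhenomena.CardyFormulaZ2.Cruxes.SubseqCardy.Birth

open Set MeasureTheory
open Literature.Probability.LatticeModels (Site zdGraph)
open Literature.Probability.Percolation

namespace Lattice

/-- The right part `{a₁ + 1 ≤ x₀}` of the rectangle `[0, a₁ + a₂ + 1] × [0, b]` is the translate
`(a₁ + 1, 0) + [0, a₂] × [0, b]`. [folklore] -/
theorem rectangle_inter_ge_eq (a₁ a₂ b : ℕ) :
    ((↑(rectangle (a₁ + a₂ + 1) b) : Set (Site 2)) ∩ {z : Site 2 | (a₁ : ℤ) + 1 ≤ z 0}) =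
      (· + (![(a₁ : ℤ) + 1, 0] : Site 2)) '' (↑(rectangle a₂ b) : Set (Site 2)) := by
  ext z
  rw [mem_image_add_rectangle]
  simp only [mem_inter_iff, Finset.mem_coe, mem_rectangle_iff, mem_setOf_eq,
    Matrix.cons_val_zero, Matrix.cons_val_one]
  push_cast
  omega

/-- **The crossing of the long rectangle contains a crossing of its right part** (on lattice
configurations): after its last visit to the column `x = a₁ + 1`, an open left–right crossing of
`[0, a₁ + a₂ + 1] × [0, b]` is a left–right crossing of `(a₁ + 1, 0) + [0, a₂] × [0, b]`.
[cite: BollobasRiordan2006, Ch. 3, proof of eq. (3)] -/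
theorem shift_lrCrossing_of_lrCrossing_add {a₁ a₂ b : ℕ} {ω : BondConfig (Site 2)}
    (hω : ω ⊆ (zdGraph 2).edgeSet) (hc : ω ∈ lrCrossing (a₁ + a₂ + 1) b) :
    ω ∈ openCrossing ((· + (![(a₁ : ℤ) + 1, 0] : Site 2)) '' (↑(rectangle a₂ b) : Set (Site 2)))
      ((· + (![(a₁ : ℤ) + 1, 0] : Site 2)) '' (↑(leftSide a₂ b) : Set (Site 2)))
      ((· + (![(a₁ : ℤ) + 1, 0] : Site 2)) '' (↑(rightSide a₂ b) : Set (Site 2))) := by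
  obtain ⟨x, hx, y, hy, hxy⟩ := hc
  simp only [Finset.mem_coe, leftSide, rightSide, Finset.mem_filter, mem_rectangle_iff] at hx hy
  rw [openConnIn_comm] at hxy
  obtain ⟨z, hz, hr⟩ := exists_openConnIn_column_ge hω ((a₁ : ℤ) + 1) (by rw [hy.2]; push_cast; omega)
    (by rw [hx.2]; positivity) hxy
  rw [rectangle_inter_ge_eq] at hr
  rw [openCrossing_comm]
  obtain ⟨hyS, hzS, hreach⟩ := hr
  refine ⟨y, ?_, z, ?_, ⟨hyS, hzS, hreach⟩⟩
  · rw [mem_image_add_rightSide]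
    rw [mem_image_add_rectangle] at hyS
    refine ⟨hyS, ?_⟩
    simp only [Matrix.cons_val_zero]
    rw [hy.2]; push_cast; ring
  · rw [mem_image_add_leftSide]
    rw [mem_image_add_rectangle] at hzS
    exact ⟨hzS, by simpa using hz⟩

/-- The pairs of vertices of the left part and of the right part are disjoint. [folklore] -/
theorem disjoint_sym2 (a₁ a₂ b : ℕ) :
    Disjoint ((↑(rectangle a₁ b).sym2 : Set (Sym2 (Site 2))))
      (↑((rectangle a₂ b).image (· + (![(a₁ : ℤ) + 1, 0] : Site 2))).sym2 : Set (Sym2 (Site 2))) := by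
  rw [Finset.disjoint_coe, Finset.disjoint_left]
  intro e h₁ h₂
  induction e using Sym2.ind with
  | h w w' =>
    rw [Finset.mem_sym2_iff] at h₁ h₂
    have hw₁ := h₁ w (Sym2.mem_mk_left w w')
    have hw₂ := h₂ w (Sym2.mem_mk_left w w')
    rw [mem_rectangle_iff] at hw₁
    rw [← Finset.mem_coe, Finset.coe_image, mem_image_add_rectangle] at hw₂
    simp only [Matrix.cons_val_zero] at hw₂
    omega

/-- **Sub-multiplicativity of crossing probabilities**: for bond percolation on `ℤ²` with any
parameter `p`, `P_p(LR([0, a₁ + a₂ + 1] × [0, b])) ≤ P_p(LR([0, a₁] × [0, b])) · P_p(LR([0, a₂] × [0, b]))`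
— the long crossing forces crossings of the two parts, which are independent (disjoint edge sets)
and the right one is a translate. [cite: BollobasRiordan2006, Ch. 3, proof of eq. (3)] -/
theorem crossingProb_add_succ_le_mul (p : unitInterval) (a₁ a₂ b : ℕ) :
    crossingProb p (a₁ + a₂ + 1) b ≤ crossingProb p a₁ b * crossingProb p a₂ b := by
  set v : Site 2 := ![(a₁ : ℤ) + 1, 0] with hv
  set A : Set (BondConfig (Site 2)) := lrCrossing a₁ b with hA
  set B : Set (BondConfig (Site 2)) := openCrossing ((· + v) '' (↑(rectangle a₂ b) : Set (Site 2)))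
      ((· + v) '' (↑(leftSide a₂ b) : Set (Site 2))) ((· + v) '' (↑(rightSide a₂ b) : Set (Site 2))) with hB
  -- (1) the long crossing lies in `A ∩ B` almost surely
  have hsub : crossingProb p (a₁ + a₂ + 1) b ≤ (bondPercolation (zdGraph 2) p).real (A ∩ B) := by
    unfold crossingProb
    refine ENNReal.toReal_mono (measure_ne_top _ _) (measure_mono_ae ?_)
    filter_upwards [ae_subset_edgeSet (zdGraph 2) p] with ω hω hc
    exact ⟨lrCrossing_anti_left (by omega) b hω hc, shift_lrCrossing_of_lrCrossing_add hω hc⟩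
  -- (2) independence of `A` and `B`
  have hBset : B = openCrossing (↑((rectangle a₂ b).image (· + v)) : Set (Site 2))
      ((· + v) '' (↑(leftSide a₂ b) : Set (Site 2))) ((· + v) '' (↑(rightSide a₂ b) : Set (Site 2))) := by
    rw [hB, Finset.coe_image]
  have hAdet : DeterminedBy A (↑(rectangle a₁ b).sym2 : Set (Sym2 (Site 2))) :=
    PlanarDuality.determinedBy_openCrossing _ _ _
  have hBdet : DeterminedBy B (↑((rectangle a₂ b).image (· + v)).sym2 : Set (Sym2 (Site 2))) := by
    rw [hBset]; exact PlanarDuality.determinedBy_openCrossing _ _ _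
  have hAm : MeasurableSet A := measurableSet_openCrossing _ _ _
  have hBm : MeasurableSet B := by rw [hBset]; exact measurableSet_openCrossing _ _ _
  have hind := bondPercolation_real_inter_of_disjoint (zdGraph 2) p (disjoint_sym2 a₁ a₂ b) hAdet hBdet hAm hBm
  -- (3) the translate has the probability of `LR([0, a₂] × [0, b])`
  have hBval : (bondPercolation (zdGraph 2) p).real B = crossingProb p a₂ b := by
    rw [hB, real_openCrossing_shift]; rfl
  calc crossingProb p (a₁ + a₂ + 1) b ≤ (bondPercolation (zdGraph 2) p).real (A ∩ B) := hsub
    _ = (bondPercolation (zdGraph 2) p).real A * (bondPercolation (zdGraph 2) p).real B := hind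
    _ = crossingProb p a₁ b * crossingProb p a₂ b := by rw [hBval]; rfl

/-- **Iterated form**: `P_p(LR([0, k (a + 1) + a] × [0, b])) ≤ P_p(LR([0, a] × [0, b])) ^ (k + 1)`.
[cite: BollobasRiordan2006, Ch. 3, proof of eq. (3)] -/
theorem crossingProb_le_pow (p : unitInterval) (a b k : ℕ) :
    crossingProb p (k * (a + 1) + a) b ≤ crossingProb p a b ^ (k + 1) := by
  induction k with
  | zero => simp
  | succ k ih =>
    have h := crossingProb_add_succ_le_mul p (k * (a + 1) + a) a b
    have e : (k + 1) * (a + 1) + a = k * (a + 1) + a + a + 1 := by ring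
    rw [e]
    refine h.trans ?_
    rw [pow_succ]
    exact mul_le_mul_of_nonneg_right ih (crossingProb_mem_Icc p a b).1

end Lattice

/-- **Sub-goal `crossingProb_submultiplicative` (line `registered`, lead c5; kernel facts, lattice
input) — sub-multiplicativity of the bond-`ℤ²` rectangle crossing probabilities**:
`P_p(LR([0, a₁ + a₂ + 1] × [0, b])) ≤ P_p(LR([0, a₁] × [0, b])) · P_p(LR([0, a₂] × [0, b]))` for every
`p`, `a₁`, `a₂`, `b`. [cite: BollobasRiordan2006, Ch. 3, proof of eq. (3)] -/
theorem crossingProb_submultiplicative : ∀ (p : unitInterval) (a₁ a₂ b : ℕ), Literature.Probability.Percolation.crossingProb p (a₁ + a₂ + 1) b ≤ Literature.Probability.Percolation.crossingProb p a₁ b * Literature.Probability.Percolation.crossingProb p a₂ b :=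
  Lattice.crossingProb_add_succ_le_mul

end Summit.CriticalPhenomena.CardyFormulaZ2.Cruxes.SubseqCardy.Birth

end
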